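import Summits.AtomisticToContinuum.Crystallization.Theorems.FrustratedLawDichotomyTwoShellRigidityCut

/-!
# FrustratedLawDichotomy · crux `AperiodicFrustratedLawGap` (stmt-AtomisticToContinuum-27623) — BOND-GRAPH WINDOWS: the scale-free
# inequalities every finite mirror extracts from `bondGraph θ y` (decomp-a2c, prover hand 2, gen 9)

The reductions `cappedRigidityAt_of_cert` (p820515), `exists_coupledCluster` (p820984), `linkClassification_of_linkCert` (p821557) and
`extractionAt_of_contactSeparating` (p820807) all re-derive the same four facts about the scale-free bond graph
(`bondGraph θ y`: `j ∼ k ⟺ j ≠ k ∧ dist ≤ (1+θ)·min (nd j) (nd k)`, `nd` = own nearest-neighbour distance).  Here they are ONCE, def-free and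
WITHOUT rescaling (pure `dist` inequalities), for the next mirrors (P's «no twist» / «cap match», lens-4's two-shell statements):

* `one_add_pos_of_adj` : a bond in an injective configuration forces `0 < 1 + θ`;
* `nearestDist_pos_of_adj` : … and `0 < nd j` at both ends;
* `dist_le_mul_dist_of_adj` : **coupling** `j ∼ k ⇒ dist j k ≤ (1+θ)·dist j l` for every third site `l ≠ j` (`nd j ≤ dist j l`);
* `min_dist_lt_dist_of_not_adj` : **non-bond strictness** `j ≁ k`, `j ≠ k`, `j ∼ j'`, `k ∼ k' ⇒ min (dist j j') (dist k k') < dist j k`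
  (the witnesses `j', k'` bound the unknown `nd j`, `nd k` from below: `(1+θ)·nd j ≥ dist j j'`);
* `nearestDist_le_mul_nearestDist_of_adj`, `dist_le_sq_mul_nearestDist_of_adj_adj` : comparable scales of bonded sites and the
  two-shell window `dist j k ≤ (1+θ)²·nd i` for `i ∼ j ∼ k` (radial windows themselves are the tree's `nearestDist_le_dist` / `dist_le_of_adj`).
`[folklore]`; def-free; no `sorry`.
-/

noncomputable section

namespace Summit.AtomisticToContinuum.Crystallization.Theorems.FrustratedLawDichotomyBondGraphWindows

open Literature.Geometry.DiscreteGeometry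

variable {ι X : Type*} [MetricSpace X] {θ : ℝ} {y : ι → X}

/-- A bond between distinct points of an injective configuration forces `0 < 1 + θ`. [folklore] -/
theorem one_add_pos_of_adj (hy : Function.Injective y) {j k : ι} (h : (bondGraph θ y).Adj j k) : 0 < 1 + θ := by
  obtain ⟨hne, hle⟩ := bondGraph_adj.1 h
  have hpos : 0 < dist (y j) (y k) := dist_pos.2 fun e => hne (hy e)
  have hmin : 0 ≤ min (nearestDist y j) (nearestDist y k) := le_min (nearestDist_nonneg _ _) (nearestDist_nonneg _ _)
  by_contra hneg
  have hle' : (1 + θ) * min (nearestDist y j) (nearestDist y k) ≤ 0 :=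
    mul_nonpos_of_nonpos_of_nonneg (not_lt.1 hneg) hmin
  linarith

/-- A bond forces `0 < nd j` (the bond length is positive and `≤ (1+θ)·nd j`). [folklore] -/
theorem nearestDist_pos_of_adj (hy : Function.Injective y) {j k : ι} (h : (bondGraph θ y).Adj j k) : 0 < nearestDist y j := by
  obtain ⟨hne, hle⟩ := bondGraph_adj.1 h
  have hθ := one_add_pos_of_adj hy h
  have hpos : 0 < dist (y j) (y k) := dist_pos.2 fun e => hne (hy e)
  have h1 : dist (y j) (y k) ≤ (1 + θ) * nearestDist y j := dist_le_of_adj hθ.le h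
  by_contra hneg
  have : (1 + θ) * nearestDist y j ≤ 0 := mul_nonpos_of_nonneg_of_nonpos hθ.le (not_lt.1 hneg)
  linarith

/-- **Coupling**: `j ∼ k ⇒ dist j k ≤ (1+θ)·dist j l` for every third site `l ≠ j` (for `0 ≤ 1 + θ`). [folklore] -/
theorem dist_le_mul_dist_of_adj (hθ : 0 ≤ 1 + θ) {j k l : ι} (h : (bondGraph θ y).Adj j k) (hl : l ≠ j) :
    dist (y j) (y k) ≤ (1 + θ) * dist (y j) (y l) :=
  (dist_le_of_adj hθ h).trans (mul_le_mul_of_nonneg_left (nearestDist_le_dist y hl) hθ)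

/-- **Coupling at the other end**: `j ∼ k ⇒ dist j k ≤ (1+θ)·dist k l` for every `l ≠ k`. [folklore] -/
theorem dist_le_mul_dist_of_adj' (hθ : 0 ≤ 1 + θ) {j k l : ι} (h : (bondGraph θ y).Adj j k) (hl : l ≠ k) :
    dist (y j) (y k) ≤ (1 + θ) * dist (y k) (y l) := by
  rw [dist_comm (y j)]
  exact dist_le_mul_dist_of_adj hθ h.symm hl

/-- **Non-bond strictness**: if `j ≠ k` are NOT bonded while `j ∼ j'` and `k ∼ k'`, then `min (dist j j') (dist k k') < dist j k`
(for `0 ≤ 1 + θ`). [folklore] -/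
theorem min_dist_lt_dist_of_not_adj (hθ : 0 ≤ 1 + θ) {j k j' k' : ι} (hjk : j ≠ k) (hnot : ¬ (bondGraph θ y).Adj j k)
    (hj : (bondGraph θ y).Adj j j') (hk : (bondGraph θ y).Adj k k') :
    min (dist (y j) (y j')) (dist (y k) (y k')) < dist (y j) (y k) := by
  have hgt : (1 + θ) * min (nearestDist y j) (nearestDist y k) < dist (y j) (y k) := by
    by_contra hle
    exact hnot (bondGraph_adj.2 ⟨hjk, not_lt.1 hle⟩)
  have h1 := dist_le_of_adj hθ hj
  have h2 := dist_le_of_adj hθ hk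
  rw [mul_min_of_nonneg _ _ hθ] at hgt
  exact lt_of_le_of_lt (min_le_min h1 h2) hgt

/-- **Own scale of a neighbour**: `i ∼ j ⇒ nd i ≤ (1+θ)·nd j` and `nd j ≤ (1+θ)·nd i` (`nearestDist_le_mul_of_adj`, both ways). [folklore] -/
theorem nearestDist_le_mul_nearestDist_of_adj (hθ : 0 ≤ 1 + θ) {i j : ι} (h : (bondGraph θ y).Adj i j) :
    nearestDist y i ≤ (1 + θ) * nearestDist y j ∧ nearestDist y j ≤ (1 + θ) * nearestDist y i :=
  ⟨nearestDist_le_mul_of_adj hθ h, nearestDist_le_mul_of_adj hθ h.symm⟩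

/-- **Two-shell window**: if `i ∼ j` and `j ∼ k` then `dist j k ≤ (1+θ)²·nd i` (the neighbour's bonds measured at the centre's scale).
[folklore] -/
theorem dist_le_sq_mul_nearestDist_of_adj_adj (hθ : 0 ≤ 1 + θ) {i j k : ι} (hij : (bondGraph θ y).Adj i j)
    (hjk : (bondGraph θ y).Adj j k) : dist (y j) (y k) ≤ (1 + θ) ^ 2 * nearestDist y i := by
  have h1 := dist_le_of_adj hθ hjk
  have h2 := mul_le_mul_of_nonneg_left (nearestDist_le_mul_of_adj hθ hij.symm) hθ
  calc dist (y j) (y k) ≤ (1 + θ) * nearestDist y j := h1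
    _ ≤ (1 + θ) * ((1 + θ) * nearestDist y i) := h2
    _ = (1 + θ) ^ 2 * nearestDist y i := by ring

end Summit.AtomisticToContinuum.Crystallization.Theorems.FrustratedLawDichotomyBondGraphWindows

end
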